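import Literature.Probability.Percolation.FlipResponse
import Literature.Probability.Percolation.SiteEmbDomainCrossing
import HarnessLib

/-!
# Open arms of the configurations whose crossing a diagonal flip creates or destroys

Helper file for the crux `QuadrupoleSelectionRule` (stmt-CriticalPhenomena-7029, informal) of route
`CardyFlipRusso` (sub-problem `CardyFormulaZ2`), line `Sketch` (generation 4), stubs R3a
(`crossing_flipGraph_sdiff_subset_arms`) and R3b (`crossing_sdiff_flipGraph_subset_arms`): the
open-arm half of the four-arm localisation of the flip response of a crossing event.

Let `flipGraph G A B C D = (G ∖ AC) ⊔ BD` be the diagonal flip of the quadrilateral `ABCD` and let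
`G₀ = G ∖ AC = G.deleteEdges {s(A, C)}` be the diagonal-free graph, a common subgraph of `G` and of
the flipped graph.  For a site configuration `ω` and a domain `S`:

* (R3a) if `ω` has an open crossing `u ⟷ v in S` (`u ∈ X`, `v ∈ Y`) in the flipped graph but none
  in `G`, then in `G₀` it has open arms inside `S` from `X` to `B` and from `D` to `Y`, or from `X`
  to `D` and from `B` to `Y`;
* (R3b) if `ω` has an open crossing in `G` but none in the flipped graph, then in `G₀` it has open
  arms inside `S` from `X` to `A` and from `C` to `Y`, or from `X` to `C` and from `A` to `Y`.

Both are instances of one splitting lemma (`FlipArms.reachable_or_arms_of_adj_imp`): if every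
edge of `H` is an edge of `H'` or the edge `PQ`, then two `H`-connected vertices are either
`H'`-connected or `H'`-connected to the two ends of `PQ` (induction on a walk: the LAST passage
through `PQ` splits it).  For R3a, `H`/`H'` are the open subgraphs (induced on `S`) of the flipped
graph and of `G₀`, `PQ = BD`, and an `H'`-connection would be a `G`-connection (`G₀ ≤ G`); for R3b
they are the open subgraphs of `G` and of `G₀`, `PQ = AC`, and `G₀ ≤ flipGraph G A B C D`.
No hypothesis on the quadrilateral, the domain or the configuration is needed.

## References

* V. Beffara, *Is critical 2D percolation universal?* (2008), §5.2 Prop. 18 (four-arm structure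
  of the flip response).
* G. Grimmett, *Percolation* (1999), §2.4 (pivotality).
-/

noncomputable section

namespace Summit.CriticalPhenomena.CardyFormulaZ2.Theorems

open Literature.Probability.Percolation

variable {V : Type*}

namespace FlipArms

/-! ### A walk using one extra edge splits at that edge -/

/-- **Splitting lemma.** If every edge of `H` is an edge of `H'` or the edge `{P, Q}`, then two
`H`-reachable vertices `x, y` are `H'`-reachable, or `PQ` is an edge of `H` and
(`x ~ P`, `Q ~ y` in `H'`) or (`x ~ Q`, `P ~ y` in `H'`).  Induction on a walk from `x` to `y`.
[folklore] -/
theorem reachable_or_arms_of_adj_imp {W : Type*} {H H' : SimpleGraph W} {P Q : W}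
    (h : ∀ ⦃x y : W⦄, H.Adj x y → H'.Adj x y ∨ (x = P ∧ y = Q) ∨ (x = Q ∧ y = P)) {x y : W}
    (hxy : H.Reachable x y) :
    H'.Reachable x y ∨ (H.Adj P Q ∧
      ((H'.Reachable x P ∧ H'.Reachable Q y) ∨ (H'.Reachable x Q ∧ H'.Reachable P y))) := by
  obtain ⟨p⟩ := hxy
  induction p with
  | nil => exact Or.inl (SimpleGraph.Reachable.refl _)
  | cons hadj _ ih =>
    rcases h hadj with h' | ⟨rfl, rfl⟩ | ⟨rfl, rfl⟩
    · rcases ih with r | ⟨hPQ, ⟨r₁, r₂⟩ | ⟨r₁, r₂⟩⟩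
      · exact Or.inl (h'.reachable.trans r)
      · exact Or.inr ⟨hPQ, Or.inl ⟨h'.reachable.trans r₁, r₂⟩⟩
      · exact Or.inr ⟨hPQ, Or.inr ⟨h'.reachable.trans r₁, r₂⟩⟩
    · -- the step is `P → Q`
      rcases ih with r | ⟨hPQ, ⟨-, r₂⟩ | ⟨-, r₂⟩⟩
      · exact Or.inr ⟨hadj, Or.inl ⟨SimpleGraph.Reachable.refl _, r⟩⟩
      · exact Or.inr ⟨hPQ, Or.inl ⟨SimpleGraph.Reachable.refl _, r₂⟩⟩
      · exact Or.inl r₂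
    · -- the step is `Q → P`
      rcases ih with r | ⟨hPQ, ⟨-, r₂⟩ | ⟨-, r₂⟩⟩
      · exact Or.inr ⟨hadj.symm, Or.inr ⟨SimpleGraph.Reachable.refl _, r⟩⟩
      · exact Or.inl r₂
      · exact Or.inr ⟨hPQ, Or.inr ⟨SimpleGraph.Reachable.refl _, r₂⟩⟩

/-! ### Site-percolation bookkeeping -/

/-- Adjacency in the open subgraph induced on the domain `S`. [folklore] -/
theorem induce_siteOpenGraph_adj (G : SimpleGraph V) (ω : SiteConfig V) (S : Set V) (x y : S) :
    ((siteOpenGraph G ω).induce S).Adj x y ↔ G.Adj x y ∧ (x : V) ∈ ω ∧ (y : V) ∈ ω := by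
  simp only [SimpleGraph.comap_adj, Function.Embedding.coe_subtype, siteOpenGraph_adj]

/-- **Open arms from the ends of the extra edge.** Let `G₀ ≤ G₂` and let every edge of `G₁` be an
edge of `G₀` or the edge `{P, Q}`.  A configuration with an open crossing `X ⟷ Y` inside `S` in
`G₁` but not in `G₂` has, in `G₀` and inside `S`, open arms from `X` to `P` and from `Q` to `Y`,
or from `X` to `Q` and from `P` to `Y`. [folklore] -/
theorem arms_of_crossing_of_not_crossing {G₁ G₀ G₂ : SimpleGraph V} {P Q : V}
    (h₁ : ∀ ⦃x y : V⦄, G₁.Adj x y → G₀.Adj x y ∨ s(x, y) = s(P, Q)) (h₂ : G₀ ≤ G₂)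
    {S X Y : Set V} {ω : SiteConfig V} (hω : ∃ u ∈ X, ∃ v ∈ Y, ω ∈ siteConnIn G₁ S u v)
    (hω' : ¬∃ u ∈ X, ∃ v ∈ Y, ω ∈ siteConnIn G₂ S u v) :
    ((∃ u ∈ X, ω ∈ siteConnIn G₀ S u P) ∧ ∃ v ∈ Y, ω ∈ siteConnIn G₀ S Q v) ∨
      ((∃ u ∈ X, ω ∈ siteConnIn G₀ S u Q) ∧ ∃ v ∈ Y, ω ∈ siteConnIn G₀ S P v) := by
  obtain ⟨u, hu, v, hv, huω, hvω, huS, hvS, hr⟩ := hω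
  -- an open `G₀`-connection `u ⟷ v` inside `S` would be a `G₂`-crossing
  have give : ¬((siteOpenGraph G₀ ω).induce S).Reachable ⟨u, huS⟩ ⟨v, hvS⟩ := fun r =>
    hω' ⟨u, hu, v, hv, siteConnIn_mono_graph h₂ S u v ⟨huω, hvω, huS, hvS, r⟩⟩
  -- every open `G₁`-edge inside `S` is an open `G₀`-edge or the (open) edge `PQ`
  have hadj : ∀ ⦃x y : S⦄, ((siteOpenGraph G₁ ω).induce S).Adj x y →
      ((siteOpenGraph G₀ ω).induce S).Adj x y ∨
        (s((x : V), (y : V)) = s(P, Q) ∧ (x : V) ∈ ω ∧ (y : V) ∈ ω) := by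
    intro x y hxy
    rw [induce_siteOpenGraph_adj] at hxy ⊢
    obtain ⟨hG, hx, hy⟩ := hxy
    rcases h₁ hG with h | h
    · exact Or.inl ⟨h, hx, hy⟩
    · exact Or.inr ⟨h, hx, hy⟩
  by_cases hPQ : P ∈ S ∧ Q ∈ S
  · obtain ⟨hPS, hQS⟩ := hPQ
    have key := reachable_or_arms_of_adj_imp (H := (siteOpenGraph G₁ ω).induce S)
      (H' := (siteOpenGraph G₀ ω).induce S) (P := (⟨P, hPS⟩ : S)) (Q := (⟨Q, hQS⟩ : S))
      (fun x y hxy => ?_) hr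
    · rcases key with r | ⟨hPQadj, harms⟩
      · exact (give r).elim
      · obtain ⟨-, hPω, hQω⟩ := (induce_siteOpenGraph_adj G₁ ω S _ _).1 hPQadj
        rcases harms with ⟨r₁, r₂⟩ | ⟨r₁, r₂⟩
        · exact Or.inl ⟨⟨u, hu, huω, hPω, huS, hPS, r₁⟩, v, hv, hQω, hvω, hQS, hvS, r₂⟩
        · exact Or.inr ⟨⟨u, hu, huω, hQω, huS, hQS, r₁⟩, v, hv, hPω, hvω, hPS, hvS, r₂⟩
    · rcases hadj hxy with h | ⟨h, -, -⟩
      · exact Or.inl h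
      · right
        rcases Sym2.eq_iff.1 h with ⟨hx, hy⟩ | ⟨hx, hy⟩
        · exact Or.inl ⟨Subtype.ext hx, Subtype.ext hy⟩
        · exact Or.inr ⟨Subtype.ext hx, Subtype.ext hy⟩
  · -- an end of `PQ` lies outside `S`: the edge `PQ` is never used inside `S`
    refine (give (hr.mono fun x y hxy => ?_)).elim
    rcases hadj hxy with h | ⟨h, -, -⟩
    · exact h
    · refine (hPQ ?_).elim
      rcases Sym2.eq_iff.1 h with ⟨hx, hy⟩ | ⟨hx, hy⟩
      · exact ⟨hx ▸ x.2, hy ▸ y.2⟩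
      · exact ⟨hy ▸ y.2, hx ▸ x.2⟩

/-! ### The two graph comparisons around a diagonal flip -/

/-- Every edge of the flipped graph is an edge of `G ∖ AC` or the new diagonal `BD`. [folklore] -/
theorem flipGraph_adj_imp_deleteEdges_adj_or (G : SimpleGraph V) (A B C D : V) ⦃x y : V⦄
    (h : (flipGraph G A B C D).Adj x y) :
    (G.deleteEdges {s(A, C)}).Adj x y ∨ s(x, y) = s(B, D) := by
  rcases (flipGraph_adj G A B C D x y).1 h with ⟨hG, hne⟩ | ⟨hBD, -⟩
  · exact Or.inl (SimpleGraph.deleteEdges_adj.2 ⟨hG, by rwa [Set.mem_singleton_iff]⟩)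
  · exact Or.inr hBD.symm

/-- Every edge of `G` is an edge of `G ∖ AC` or the old diagonal `AC`. [folklore] -/
theorem adj_imp_deleteEdges_adj_or (G : SimpleGraph V) (A C : V) ⦃x y : V⦄ (h : G.Adj x y) :
    (G.deleteEdges {s(A, C)}).Adj x y ∨ s(x, y) = s(A, C) := by
  by_cases hAC : s(x, y) = s(A, C)
  · exact Or.inr hAC
  · exact Or.inl (SimpleGraph.deleteEdges_adj.2 ⟨h, by rwa [Set.mem_singleton_iff]⟩)

/-- `G ∖ AC` is a subgraph of the flipped graph `(G ∖ AC) ⊔ BD`. [folklore] -/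
theorem deleteEdges_le_flipGraph (G : SimpleGraph V) (A B C D : V) :
    G.deleteEdges {s(A, C)} ≤ flipGraph G A B C D :=
  fun x y h => (flipGraph_adj G A B C D x y).2
    (Or.inl ⟨h.1, by simpa only [Set.mem_singleton_iff] using (SimpleGraph.deleteEdges_adj.1 h).2⟩)

end FlipArms

/-! ### The registered stubs -/

/-- **Stub R3a: open arms of what a flip creates.**  A configuration with a crossing from `X` to
`Y` inside `S` in the flipped graph (diagonal `BD`) but not in `G` has open arms, inside `S` and
in the diagonal-free graph `G ∖ AC`, from `X` to `B` and from `D` to `Y`, or from `X` to `D` and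
from `B` to `Y` (an open path new after the flip passes through `BD`; split it at its last
passage). [folklore] -/
theorem crossing_flipGraph_sdiff_subset_arms : ∀ (W : Type*) (G : SimpleGraph W) (A B C D : W)
    (S X Y : Set W), {ω : Literature.Probability.Percolation.SiteConfig W | ∃ u ∈ X, ∃ v ∈ Y, ω ∈
    Literature.Probability.Percolation.siteConnIn (Literature.Probability.Percolation.flipGraph G
    A B C D) S u v} \ {ω | ∃ u ∈ X, ∃ v ∈ Y, ω ∈ Literature.Probability.Percolation.siteConnIn G
    S u v} ⊆ {ω | ((∃ u ∈ X, ω ∈ Literature.Probability.Percolation.siteConnIn (G.deleteEdges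
    {s(A, C)}) S u B) ∧ (∃ v ∈ Y, ω ∈ Literature.Probability.Percolation.siteConnIn
    (G.deleteEdges {s(A, C)}) S D v)) ∨ ((∃ u ∈ X, ω ∈
    Literature.Probability.Percolation.siteConnIn (G.deleteEdges {s(A, C)}) S u D) ∧ (∃ v ∈ Y, ω
    ∈ Literature.Probability.Percolation.siteConnIn (G.deleteEdges {s(A, C)}) S B v))} := by
  intro W G A B C D S X Y ω hω
  exact FlipArms.arms_of_crossing_of_not_crossing
    (FlipArms.flipGraph_adj_imp_deleteEdges_adj_or G A B C D) (SimpleGraph.deleteEdges_le _)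
    hω.1 hω.2

/-- **Stub R3b: open arms of what a flip destroys.**  A configuration with a crossing from `X`
to `Y` inside `S` in `G` (diagonal `AC`) but not in the flipped graph has open arms, inside `S`
and in `G ∖ AC`, from `X` to `A` and from `C` to `Y`, or from `X` to `C` and from `A` to `Y`
(an open path lost by the flip passes through `AC`, since `G ∖ AC` survives the flip).
[folklore] -/
theorem crossing_sdiff_flipGraph_subset_arms : ∀ (W : Type*) (G : SimpleGraph W) (A B C D : W)
    (S X Y : Set W), {ω : Literature.Probability.Percolation.SiteConfig W | ∃ u ∈ X, ∃ v ∈ Y, ω ∈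
    Literature.Probability.Percolation.siteConnIn G S u v} \ {ω | ∃ u ∈ X, ∃ v ∈ Y, ω ∈
    Literature.Probability.Percolation.siteConnIn (Literature.Probability.Percolation.flipGraph G
    A B C D) S u v} ⊆ {ω | ((∃ u ∈ X, ω ∈ Literature.Probability.Percolation.siteConnIn
    (G.deleteEdges {s(A, C)}) S u A) ∧ (∃ v ∈ Y, ω ∈
    Literature.Probability.Percolation.siteConnIn (G.deleteEdges {s(A, C)}) S C v)) ∨ ((∃ u ∈ X,
    ω ∈ Literature.Probability.Percolation.siteConnIn (G.deleteEdges {s(A, C)}) S u C) ∧ (∃ v ∈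
    Y, ω ∈ Literature.Probability.Percolation.siteConnIn (G.deleteEdges {s(A, C)}) S A v))} := by
  intro W G A B C D S X Y ω hω
  exact FlipArms.arms_of_crossing_of_not_crossing (FlipArms.adj_imp_deleteEdges_adj_or G A C)
    (FlipArms.deleteEdges_le_flipGraph G A B C D) hω.1 hω.2

end Summit.CriticalPhenomena.CardyFormulaZ2.Theorems

end
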